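import Mathlib.Analysis.Normed.Affine.MazurUlam
import Mathlib.Analysis.Complex.Isometry
import Literature.Probability.RandomPlanarGeometry.LatticeSimilarityCovariance
import HarnessLib

/-!
# Isometry covariance of chordal curve families (Euclidean covariance with reflections, no dilations)

Topic `Literature/Probability/RandomPlanarGeometry` (definition item
`defn-ChordalFamily.IsIsometryCovariant`, for the informal crux `EuclideanLocalRigiditySLE6`,
`stmt-CriticalPhenomena-6806`, route CardyLocalRigidity of `CriticalPhenomena/CardyFormulaZ2`).

A chordal curve family `P : DobrushinDomain → Measure (CurveClass ℂ)` (`ChordalCurveFamily.lean`)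
is **isometry covariant** when `P (φ D) = φ_* (P D)` for EVERY isometry `φ` of the Euclidean plane
`ℂ ≅ ℝ²` and every Dobrushin domain `D` — the orientation-preserving isometries `z ↦ c z + w`
(`|c| = 1`: rotations and translations) AND the orientation-reversing ones `z ↦ c z̄ + w`
(reflections and glide reflections) — and, deliberately, NOT under dilations. This file

* defines `ChordalFamily.IsIsometryCovariant P` (quantifying over the distance-preserving
  homeomorphisms `φ : ℂ ≃ₜ ℂ`, the argument type of the tree's `MarkedDomain.map`);
* proves the **classification of plane isometries** in the form needed here,
  `exists_eq_similarity_or_eq_conj_trans_of_isometry`: a distance-preserving homeomorphism of `ℂ`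
  is `similarity c hc w` or `conjLIE.toHomeomorph.trans (similarity c hc w)` with `|c| = 1`
  (Mazur–Ulam, `IsometryEquiv.toRealLinearIsometryEquiv`, and Mathlib's
  `linear_isometry_complex`), whence the explicit form
  `isIsometryCovariant_iff_similarity_conj` (the two clauses "`z ↦ c z + w`" and "`z ↦ c z̄ + w`",
  `|c| = 1`) and the generator form `isIsometryCovariant_of_similarity_of_conj`
  (rotation–translations plus the single reflection `z ↦ z̄` suffice, by `covariant_trans`);
* records the elementary relations with the tree's covariance notions:
  `IsIsometryCovariant.similarity_eq / translation_eq / conj_eq / conj_trans_similarity_eq /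
  isometryEquiv_eq` (projections); `IsSimilarityCovariant.eq_of_forall_apply` (similarity
  covariance gives covariance under every orientation-preserving isometry — indeed under every
  homeomorphism that is pointwise `z ↦ c z + w`), `IsSimilarityCovariant.isIsometryCovariant_of_conj`
  and `IsConformallyCovariant.isIsometryCovariant_of_conj` (add reflection covariance in the real
  axis and get full isometry covariance), and conversely
  `IsIsometryCovariant.isSimilarityCovariant_of_dilation` (isometry covariance plus covariance under
  the dilations `z ↦ r z`, `r > 0`, is similarity covariance — so dilation covariance is EXACTLY
  the part of `IsSimilarityCovariant` that `IsIsometryCovariant` drops);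
* non-vacuity: `isIsometryCovariant_arcFamily`, `isIsometryCovariant_tipFamily`.

## Why this notion (sources)

Werner 2007 §3.2 characterises SLE through (1) conformal covariance of the laws `P_{D,x,c}`,
(2) the domain Markov property, (3) symmetry: "for some `D, x, c` that is symmetric with respect
to the line `(xc)`, the law `P_{D,x,c}` is symmetric with respect to this line", and remarks that
"symmetry and the domain Markov property hold in the discrete case" (arXiv:0710.0856, p. 19).
Isometry covariance is condition (1) restricted from conformal maps to the orientation-preserving
isometries (the tree's `IsSimilarityCovariant`, Werner's (1) for similarities, with the dilations
`|c| ≠ 1` removed) together with the covariance form, for all reflections of the plane, of the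
symmetry (3). Dilations are left out on purpose: the near-critical scaling limits of percolation
are translation invariant and "rotationally invariant" but satisfy the scaling relation
`λ ↦ α^{-3/4} λ` under `z ↦ α z` instead of scale invariance (Garban–Pete–Schramm 2018, Cor. 86,
p. 39 of arXiv:1305.5526), so a rigidity statement for SLE₆ inside a Euclidean-covariant class must
not assume scale covariance; and since a reflection exchanges the two sides of an interface, for
interface laws that depend on `(D, a, b)` only (as locality forces, `ChordalFamily.IsLocal`)
covariance under reflections expresses the colour-exchange symmetry of critical percolation at
`p = 1/2` — the symmetry that distinguishes `λ` from `−λ` in the near-critical family. (This last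
sentence is the requester's motivation, recorded for context; nothing below depends on it.)

## Design notes

* The definition quantifies over `φ : ℂ ≃ₜ ℂ` with `Isometry φ` rather than over `ℂ ≃ᵢ ℂ` so that
  it composes directly with `MarkedDomain.map` and with the pattern of `IsSimilarityCovariant`;
  `IsIsometryCovariant.isometryEquiv_eq` is the `ℂ ≃ᵢ ℂ` form, and the explicit two-clause form is
  a THEOREM (`isIsometryCovariant_iff_similarity_conj`), so assuming `IsIsometryCovariant` is never
  stronger than assuming the two printed clauses.
* Reflections are written, as in `LatticeSimilarityCovariance.lean`, with Mathlib's
  `Complex.conjLIE.toHomeomorph : z ↦ z̄` and the composites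
  `conjLIE.toHomeomorph.trans (similarity c hc w) : z ↦ c z̄ + w`.
* `IsIsometryCovariant` neither implies nor follows from `IsLatticeSimilarityCovariant` (that notion
  has the dilations but only quarter-turn rotations); both follow from similarity covariance plus
  conjugation covariance.

## Sources

W. Werner, *Lectures on two-dimensional critical percolation*, IAS/Park City (2007),
arXiv:0710.0856, §3.2 (conditions (1)–(3), p. 19); C. Garban, G. Pete, O. Schramm, *The scaling
limits of near-critical and dynamical percolation*, JEMS 20 (2018), Cor. 86 (arXiv:1305.5526
p. 39); G. Lawler, O. Schramm, W. Werner, *Values of Brownian intersection exponents I*, Acta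
Math. 187 (2001), §3.2 (proof: "Corollary [2.3] and invariance under reflection", with the
anti-conformal automorphism of `ℍ` fixing `x` — the reflection symmetry of the SLE₆ laws is used
alongside locality). Classification of plane isometries: folklore (Mazur–Ulam; Mathlib
`Mathlib.Analysis.Complex.Isometry`).

## Mathlib / tree

Mathlib: `Isometry`, `IsometryEquiv.toRealLinearIsometryEquiv(_apply)` (Mazur–Ulam),
`linear_isometry_complex`, `rotation(_apply)`, `Circle.norm_coe`, `Circle.coe_ne_zero`,
`Complex.conjLIE`, `Homeomorph.ext`, `Measure.map_dirac'`. Tree: `ChordalFamily`,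
`IsSimilarityCovariant`, `IsConformallyCovariant(.isSimilarityCovariant)`, `similarity(_apply)`,
`measurable_curveClassMap_similarity`, `MarkedDomain.map`, `arcCurve_map`, `arcFamily`, `tipFamily`
(ChordalCurveFamily); `covariant_trans`, `MarkedDomain.map_map`, `CurveClass.map_homeomorph_trans`,
`conjLIE_toHomeomorph_trans_similarity_apply`, `measurable_curveClassMap_conj`
(LatticeSimilarityCovariance). Searched (`lean search 'IsometryCovariant|ReflectionCovariant'`):
no such notion in Mathlib or Literature (only the request text in the route file).
-/

noncomputable section

open Set MeasureTheory Topology Filter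
open scoped ComplexConjugate

namespace Literature.Probability.RandomPlanarGeometry

/-! ### Isometries of the plane as homeomorphisms -/

/-- A similarity `z ↦ c z + w` with `|c| = 1` (a rotation followed by a translation) preserves
distances. [folklore] -/
theorem isometry_similarity {c : ℂ} (hc : c ≠ 0) (h1 : ‖c‖ = 1) (w : ℂ) :
    Isometry (similarity c hc w) :=
  Isometry.of_dist_eq fun x y => by
    rw [similarity_apply, similarity_apply, dist_add_right, dist_eq_norm, dist_eq_norm, ← mul_sub,
      norm_mul, h1, one_mul]

/-- A similarity `z ↦ c z + w` preserves distances iff `|c| = 1`. [folklore] -/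
theorem isometry_similarity_iff {c : ℂ} (hc : c ≠ 0) (w : ℂ) :
    Isometry (similarity c hc w) ↔ ‖c‖ = 1 := by
  refine ⟨fun h => ?_, fun h1 => isometry_similarity hc h1 w⟩
  simpa [dist_eq_norm] using h.dist_eq 1 0

/-- Complex conjugation `z ↦ z̄` (the reflection in the real axis) preserves distances. [folklore] -/
theorem isometry_conjLIE_toHomeomorph : Isometry (Complex.conjLIE.toHomeomorph : ℂ ≃ₜ ℂ) :=
  Complex.conjLIE.isometry

/-- The orientation-reversing maps `z ↦ c z̄ + w` with `|c| = 1` (reflections and glide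
reflections) preserve distances. [folklore] -/
theorem isometry_conjLIE_toHomeomorph_trans_similarity {c : ℂ} (hc : c ≠ 0) (h1 : ‖c‖ = 1)
    (w : ℂ) : Isometry (Complex.conjLIE.toHomeomorph.trans (similarity c hc w)) :=
  (isometry_similarity hc h1 w).comp Complex.conjLIE.isometry

/-- A distance-preserving homeomorphism of the plane is `1`-Lipschitz as a continuous map.
[folklore] -/
theorem lipschitzWith_of_isometry {φ : ℂ ≃ₜ ℂ} (hφ : Isometry φ) :
    LipschitzWith 1 ((φ : ℂ ≃ₜ ℂ) : C(ℂ, ℂ)) :=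
  hφ.lipschitz

/-- Push-forward of curve classes along a distance-preserving homeomorphism of the plane is Borel
measurable (it is `1`-Lipschitz, `CurveClass.lipschitzWith_map`). [folklore] -/
theorem measurable_curveClassMap_of_isometry {φ : ℂ ≃ₜ ℂ} (hφ : Isometry φ) :
    Measurable (CurveClass.map (φ : C(ℂ, ℂ))) :=
  (CurveClass.lipschitzWith_map (lipschitzWith_of_isometry hφ)).continuous.measurable

/-- **Classification of the isometries of the Euclidean plane.** A distance-preserving
homeomorphism `φ` of `ℂ` is either a rotation followed by a translation, `z ↦ c z + w`
(`similarity c hc w`), or a reflection / glide reflection, `z ↦ c z̄ + w`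
(`conjLIE.toHomeomorph.trans (similarity c hc w)`), with `|c| = 1` and `w = φ 0`. Proof: by
Mazur–Ulam (`IsometryEquiv.toRealLinearIsometryEquiv`) `z ↦ φ z − φ 0` is a real-linear isometry of
`ℂ`, and those are `z ↦ a z` or `z ↦ a z̄`, `|a| = 1` (Mathlib's `linear_isometry_complex`).
[folklore] -/
theorem exists_eq_similarity_or_eq_conj_trans_of_isometry {φ : ℂ ≃ₜ ℂ} (hφ : Isometry φ) :
    ∃ (c : ℂ) (hc : c ≠ 0) (w : ℂ), ‖c‖ = 1 ∧
      (φ = similarity c hc w ∨ φ = Complex.conjLIE.toHomeomorph.trans (similarity c hc w)) := by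
  have hdec : ∀ z : ℂ,
      φ z = (IsometryEquiv.toRealLinearIsometryEquiv ⟨φ.toEquiv, hφ⟩) z + φ 0 := fun z => by
    rw [IsometryEquiv.toRealLinearIsometryEquiv_apply]
    exact (sub_add_cancel (φ z) (φ 0)).symm
  obtain ⟨a, ha⟩ := linear_isometry_complex (IsometryEquiv.toRealLinearIsometryEquiv ⟨φ.toEquiv, hφ⟩)
  refine ⟨a, Circle.coe_ne_zero a, φ 0, Circle.norm_coe a, ?_⟩
  rcases ha with ha | ha
  · refine Or.inl (Homeomorph.ext fun z => ?_)
    rw [similarity_apply, hdec z, ha, rotation_apply]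
  · refine Or.inr (Homeomorph.ext fun z => ?_)
    rw [conjLIE_toHomeomorph_trans_similarity_apply, hdec z, ha, LinearIsometryEquiv.trans_apply,
      rotation_apply, Complex.conjLIE_apply]

/-- Factorisation of a general similarity into a dilation followed by a rotation–translation:
`c z + w = u (r z) + w` with `r = |c| > 0` and `u = c / |c|`, `|u| = 1`. [folklore] -/
theorem similarity_eq_dilation_trans (c : ℂ) (hc : c ≠ 0) (w : ℂ)
    (hr : ((‖c‖ : ℝ) : ℂ) ≠ 0) (hu : c / (‖c‖ : ℂ) ≠ 0) :
    similarity c hc w = (similarity (‖c‖ : ℂ) hr 0).trans (similarity (c / (‖c‖ : ℂ)) hu w) :=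
  Homeomorph.ext fun z => by
    rw [Homeomorph.trans_apply, similarity_apply, similarity_apply, similarity_apply, add_zero,
      ← mul_assoc, div_mul_cancel₀ c hr]

namespace ChordalFamily

variable {P : ChordalFamily}

/-! ### The definition -/

/-- **Isometry covariance** (Euclidean covariance, reflections INCLUDED, dilations EXCLUDED) of a
chordal curve family `P`: for every isometry `φ` of the plane `ℂ ≅ ℝ²` (a distance-preserving
homeomorphism; by `exists_eq_similarity_or_eq_conj_trans_of_isometry` these are exactly the
rotation–translations `z ↦ c z + w` and the reflections / glide reflections `z ↦ c z̄ + w`,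
`|c| = 1`) and every Dobrushin domain `(D; a, b)`, the law in the image domain
`φ(D; a, b) = (φ D; φ a, φ b)` (`MarkedDomain.map`) is the push-forward along `φ` of the law in `D`:
`P (φ D) = φ_* (P D)`. This is Werner's condition (1) (Werner 2007 §3.2: "for any conformal map
`Φ : D → D'`, the law of the image of `P_{D,x,c}` under `Φ` is `P_{D',x',c'}`") RESTRICTED to the
orientation-preserving isometries — the tree's `IsSimilarityCovariant` with the dilations removed —
together with the covariance form, for all reflections of the plane, of Werner's symmetry
condition (3) ("for some `D, x, c` that is symmetric with respect to the line `(xc)`, the law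
`P_{D,x,c}` is symmetric with respect to this line"; "symmetry and the domain Markov property hold
in the discrete case"). Scale covariance is deliberately NOT part of the notion (the near-critical
scaling limits of percolation are translation and rotation invariant but scale COvariant with
`λ ↦ α^{-3/4} λ`, Garban–Pete–Schramm 2018 Cor. 86); `isSimilarityCovariant_of_dilation` restores
it. Explicit two-clause form: `isIsometryCovariant_iff_similarity_conj`; generators:
`isIsometryCovariant_of_similarity_of_conj`. [cite: Werner2007, §3.2 conditions (1) and (3)] -/
def IsIsometryCovariant (P : ChordalFamily) : Prop :=
  ∀ (D : DobrushinDomain) (φ : ℂ ≃ₜ ℂ), Isometry φ →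
    P (D.map φ) = (P D).map (CurveClass.map (φ : C(ℂ, ℂ)))

/-- Unfolding `IsIsometryCovariant`. [folklore] -/
theorem isIsometryCovariant_iff (P : ChordalFamily) :
    P.IsIsometryCovariant ↔
      ∀ (D : DobrushinDomain) (φ : ℂ ≃ₜ ℂ), Isometry φ →
        P (D.map φ) = (P D).map (CurveClass.map (φ : C(ℂ, ℂ))) :=
  Iff.rfl

/-! ### Projections -/

/-- Isometry covariance for Mathlib's bundled isometric self-equivalences `φ : ℂ ≃ᵢ ℂ`.
[folklore] -/
theorem IsIsometryCovariant.isometryEquiv_eq (h : P.IsIsometryCovariant) (D : DobrushinDomain)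
    (φ : ℂ ≃ᵢ ℂ) :
    P (D.map φ.toHomeomorph) = (P D).map (CurveClass.map (φ.toHomeomorph : C(ℂ, ℂ))) :=
  h D φ.toHomeomorph φ.isometry

/-- Covariance under the rotation–translations `z ↦ c z + w`, `|c| = 1` (the orientation-preserving
isometries): Werner's condition (1) for these maps. [cite: Werner2007, §3.2 (1)] -/
theorem IsIsometryCovariant.similarity_eq (h : P.IsIsometryCovariant) (D : DobrushinDomain)
    {c : ℂ} (hc : c ≠ 0) (h1 : ‖c‖ = 1) (w : ℂ) :
    P (D.map (similarity c hc w)) = (P D).map (CurveClass.map (similarity c hc w : C(ℂ, ℂ))) :=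
  h D _ (isometry_similarity hc h1 w)

/-- Translation covariance (`c = 1`): `P (D + w) = (· + w)_* (P D)`. [folklore] -/
theorem IsIsometryCovariant.translation_eq (h : P.IsIsometryCovariant) (D : DobrushinDomain)
    (hc : (1 : ℂ) ≠ 0) (w : ℂ) :
    P (D.map (similarity 1 hc w)) = (P D).map (CurveClass.map (similarity 1 hc w : C(ℂ, ℂ))) :=
  h.similarity_eq D hc norm_one w

/-- Reflection covariance in the real axis: `P (D̄; ā, b̄) = conj_* (P (D; a, b))` — the covariance
form of Werner's symmetry condition (3). [cite: Werner2007, §3.2 (3)] -/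
theorem IsIsometryCovariant.conj_eq (h : P.IsIsometryCovariant) (D : DobrushinDomain) :
    P (D.map Complex.conjLIE.toHomeomorph) =
      (P D).map (CurveClass.map (Complex.conjLIE.toHomeomorph : C(ℂ, ℂ))) :=
  h D _ isometry_conjLIE_toHomeomorph

/-- Covariance under the orientation-reversing isometries `z ↦ c z̄ + w`, `|c| = 1` (reflections
in arbitrary lines and glide reflections). [folklore] -/
theorem IsIsometryCovariant.conj_trans_similarity_eq (h : P.IsIsometryCovariant)
    (D : DobrushinDomain) {c : ℂ} (hc : c ≠ 0) (h1 : ‖c‖ = 1) (w : ℂ) :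
    P (D.map (Complex.conjLIE.toHomeomorph.trans (similarity c hc w))) =
      (P D).map (CurveClass.map
        ((Complex.conjLIE.toHomeomorph.trans (similarity c hc w) : ℂ ≃ₜ ℂ) : C(ℂ, ℂ))) :=
  h D _ (isometry_conjLIE_toHomeomorph_trans_similarity hc h1 w)

/-! ### Explicit and generator forms -/

/-- **Explicit form.** `P` is isometry covariant iff it is covariant (i) under every
rotation–translation `z ↦ c z + w` and (ii) under every reflection / glide reflection
`z ↦ c z̄ + w`, `|c| = 1` — the classification of plane isometries
(`exists_eq_similarity_or_eq_conj_trans_of_isometry`). [folklore] -/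
theorem isIsometryCovariant_iff_similarity_conj (P : ChordalFamily) :
    P.IsIsometryCovariant ↔
      (∀ (D : DobrushinDomain) (c : ℂ) (hc : c ≠ 0) (w : ℂ), ‖c‖ = 1 →
          P (D.map (similarity c hc w)) =
            (P D).map (CurveClass.map (similarity c hc w : C(ℂ, ℂ)))) ∧
        ∀ (D : DobrushinDomain) (c : ℂ) (hc : c ≠ 0) (w : ℂ), ‖c‖ = 1 →
          P (D.map (Complex.conjLIE.toHomeomorph.trans (similarity c hc w))) =
            (P D).map (CurveClass.map
              ((Complex.conjLIE.toHomeomorph.trans (similarity c hc w) : ℂ ≃ₜ ℂ) : C(ℂ, ℂ))) := by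
  constructor
  · exact fun h => ⟨fun D c hc w h1 => h.similarity_eq D hc h1 w,
      fun D c hc w h1 => h.conj_trans_similarity_eq D hc h1 w⟩
  · rintro ⟨hs, hr⟩ D φ hφ
    obtain ⟨c, hc, w, h1, rfl | rfl⟩ := exists_eq_similarity_or_eq_conj_trans_of_isometry hφ
    · exact hs D c hc w h1
    · exact hr D c hc w h1

/-- **Generators suffice.** Covariance under the rotation–translations `z ↦ c z + w` (`|c| = 1`)
and under the single reflection `z ↦ z̄` already gives isometry covariance: every
orientation-reversing isometry is `z ↦ c z̄ + w`, and covariances compose (`covariant_trans`).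
[folklore] -/
theorem isIsometryCovariant_of_similarity_of_conj
    (hs : ∀ (D : DobrushinDomain) (c : ℂ) (hc : c ≠ 0) (w : ℂ), ‖c‖ = 1 →
      P (D.map (similarity c hc w)) = (P D).map (CurveClass.map (similarity c hc w : C(ℂ, ℂ))))
    (hconj : ∀ D : DobrushinDomain, P (D.map Complex.conjLIE.toHomeomorph) =
      (P D).map (CurveClass.map (Complex.conjLIE.toHomeomorph : C(ℂ, ℂ)))) :
    P.IsIsometryCovariant := by
  intro D φ hφ
  obtain ⟨c, hc, w, h1, rfl | rfl⟩ := exists_eq_similarity_or_eq_conj_trans_of_isometry hφ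
  · exact hs D c hc w h1
  · exact covariant_trans measurable_curveClassMap_conj (measurable_curveClassMap_similarity c hc w)
      hconj (fun D => hs D c hc w h1) D

/-! ### Relations with similarity and conformal covariance -/

/-- **Similarity covariance gives covariance under every orientation-preserving isometry** — in
fact under every plane homeomorphism that is pointwise `z ↦ c z + w` with `c ≠ 0` (for the
isometries, `|c| = 1`). [folklore] -/
theorem IsSimilarityCovariant.eq_of_forall_apply (h : P.IsSimilarityCovariant)
    (D : DobrushinDomain) (φ : ℂ ≃ₜ ℂ) {c : ℂ} (hc : c ≠ 0) (w : ℂ)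
    (hφ : ∀ z, φ z = c * z + w) :
    P (D.map φ) = (P D).map (CurveClass.map (φ : C(ℂ, ℂ))) := by
  obtain rfl : φ = similarity c hc w := Homeomorph.ext hφ
  exact h D c hc w

/-- A similarity covariant family (Werner's (1) for all `z ↦ c z + w`) that is also covariant under
the reflection `z ↦ z̄` (Werner's (3), covariance form) is isometry covariant.
[cite: Werner2007, §3.2 conditions (1) and (3)] -/
theorem IsSimilarityCovariant.isIsometryCovariant_of_conj (h : P.IsSimilarityCovariant)
    (hconj : ∀ D : DobrushinDomain, P (D.map Complex.conjLIE.toHomeomorph) =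
      (P D).map (CurveClass.map (Complex.conjLIE.toHomeomorph : C(ℂ, ℂ)))) :
    P.IsIsometryCovariant :=
  isIsometryCovariant_of_similarity_of_conj (fun D c hc w _ => h D c hc w) hconj

/-- A conformally covariant family that is also covariant under the reflection `z ↦ z̄` is isometry
covariant (through the tree's `IsConformallyCovariant.isSimilarityCovariant`; conjugation being
anti-conformal, the reflection clause is NOT a consequence of conformal covariance).
[cite: Werner2007, §3.2 conditions (1) and (3)] -/
theorem IsConformallyCovariant.isIsometryCovariant_of_conj (h : P.IsConformallyCovariant)
    (hconj : ∀ D : DobrushinDomain, P (D.map Complex.conjLIE.toHomeomorph) =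
      (P D).map (CurveClass.map (Complex.conjLIE.toHomeomorph : C(ℂ, ℂ)))) :
    P.IsIsometryCovariant :=
  h.isSimilarityCovariant.isIsometryCovariant_of_conj hconj

/-- The conjugation clause of an isometry covariant family, in the hypothesis shape `hconj` consumed
by `isIsometryCovariant_of_similarity_of_conj` and by the tree's
`IsSimilarityCovariant.isLatticeSimilarityCovariant`. [folklore] -/
theorem IsIsometryCovariant.conj_clause (h : P.IsIsometryCovariant) :
    ∀ D : DobrushinDomain, P (D.map Complex.conjLIE.toHomeomorph) =
      (P D).map (CurveClass.map (Complex.conjLIE.toHomeomorph : C(ℂ, ℂ))) :=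
  fun D => h.conj_eq D

/-- **Isometry covariance plus dilation covariance is similarity covariance**: if `P` is isometry
covariant and covariant under the dilations `z ↦ r z`, `r > 0`, then it is covariant under every
`z ↦ c z + w`, `c ≠ 0` (factor `c z + w = u (|c| z) + w`, `u = c / |c|`, and compose the two
covariances, `covariant_trans`). So dilation covariance is exactly what `IsIsometryCovariant` drops
from `IsSimilarityCovariant` (the scale covariance that fails in the near-critical regime,
Garban–Pete–Schramm 2018 Cor. 86). [folklore] -/
theorem IsIsometryCovariant.isSimilarityCovariant_of_dilation (h : P.IsIsometryCovariant)
    (hdil : ∀ (D : DobrushinDomain) (r : ℝ) (hr : (r : ℂ) ≠ 0), 0 < r →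
      P (D.map (similarity r hr 0)) = (P D).map (CurveClass.map (similarity r hr 0 : C(ℂ, ℂ)))) :
    P.IsSimilarityCovariant := by
  intro D c hc w
  have hr0 : (0 : ℝ) < ‖c‖ := norm_pos_iff.2 hc
  have hr : ((‖c‖ : ℝ) : ℂ) ≠ 0 := Complex.ofReal_ne_zero.2 hr0.ne'
  have hu : c / (‖c‖ : ℂ) ≠ 0 := div_ne_zero hc hr
  have hu1 : ‖c / (‖c‖ : ℂ)‖ = 1 := by
    rw [norm_div, Complex.norm_real, Real.norm_of_nonneg hr0.le, div_self hr0.ne']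
  rw [similarity_eq_dilation_trans c hc w hr hu]
  exact covariant_trans (measurable_curveClassMap_similarity _ hr 0)
    (measurable_curveClassMap_similarity _ hu w) (fun D => hdil D ‖c‖ hr hr0)
    (fun D => h.similarity_eq D hu hu1 w) D

/-! ### Non-vacuity -/

/-- `arcFamily` (Dirac mass on the boundary arc `(ab)`) is isometry covariant: the arc of `φ D` is
`φ ∘` the arc of `D` for every plane homeomorphism (`MarkedDomain.arcCurve_map`). [folklore] -/
theorem isIsometryCovariant_arcFamily : arcFamily.IsIsometryCovariant := by
  intro D φ hφ
  rw [arcFamily, arcFamily, Measure.map_dirac' (measurable_curveClassMap_of_isometry hφ),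
    CurveClass.map_mk, MarkedDomain.arcCurve_map]

/-- `tipFamily` (Dirac mass on the constant curve at `a`) is isometry covariant. [folklore] -/
theorem isIsometryCovariant_tipFamily : tipFamily.IsIsometryCovariant := by
  intro D φ hφ
  rw [tipFamily, tipFamily, Measure.map_dirac' (measurable_curveClassMap_of_isometry hφ),
    CurveClass.map_mk]
  rfl

end ChordalFamily

end Literature.Probability.RandomPlanarGeometry
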